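import Summits.ABC.IUTFork.Thm311ToCor312
import Summits.ABC.IUTFork.Cor312StatementBridges
import Summits.ABC.IUTFork.Thm311Checks
import Summits.ABC.IUTFork.Thm311Remarks
import Mathlib.LinearAlgebra.PiTensorProduct.Dual
import HarnessLib

/-!
# [IUTchIII] Cor. 3.12 over the typed Theorem 3.11 — INDEPENDENCE WITNESS (vacuity audit of the (xi-f) licence)

Record-only file (D-0012) of the abc-iut cell (Cor. 3.12 crew, seat abc-iut-c312-1, gen 3); TAKES NO SIDE. Sequel to
`Thm311ToCor312` (Steps (x), (xi-b) proved over the typed Theorem 3.11; the (xi-f) `Licence`). The cell's rule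
«vacuity-audit every fork-level hypothesis with a non-vacuity witness» applied to the licence, in the strong form the
overnight adjudication (HUMAN RULING D-0067) asks of the typed level: ONE model — a full situation of Theorem 3.11
(abc-iut-c312-1 files A–D) with a verbatim Cor.-3.12 setting (abc-iut-c312-7 `Cor312.Setting`) at its 1-column — in
which Theorem 3.11 (i) ∧ (ii) ∧ (iii) AS TYPED, (IPL) as typed (file F), the (Ind1)/(Ind2)-invariance of log-volumes
(files B, G; Step (x)), abc-iut-c312-6's bridge hypotheses `BridgeHyps` (monotone log-volume, admissibility, finite
supports, nonempty hull-sets, «−|log(Θ)| finite»), `|log(q)| > 0`, Step (i)'s pilot correspondence at the object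
level (`PilotLink`) and a functorial region algorithm (`ComputedBy`) ALL hold, while the printed Statement of Cor.
3.12 FAILS: `−|log(Θ)| = −2 < −1 = −|log(q)|` (`Checks.independence`; through c312-6's bridge: `independence_skeleton`;
universal form: `no_sufficient_reading`). The model is the "identified copies" shape in miniature: one valuation over
one place (c312-7's `Cor312.Checks.toyIndex`/`toyShells`: `log(𝒟^⊢_v) = ℚ`, only the identity as strip-automorphism
and as Ism), every region admissible with the two-valued MONOTONE log-volume `sizeVol` (`−2` inside the zero ideal,
`−1` otherwise), Θ-pilot region the zero ideal at every `m`, q-pilot region everything, hull-sets `{0}` and everything.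
It is NOT a model of initial Θ-data ([IUTchI] Def. 3.1) and says nothing about Cor. 3.12 for such data; it shows that,
at the level at which Theorem 3.11 and Corollary 3.12 are typed in this tree, the inequality is carried by the licence
alone ([IUTchIII] kurims May 2020 `paper:url-4b091feeb646`, proof of Cor. 3.12 Step (xi-f) p. 184 «… then follows
formally»; denied: Scholze–Stix 2018 §2.2; replaced by (9-1): LANA report §9 p. 46). [claim: Mochizuki2012, status: disputed]
Deliberately NOT here: any M-level instance; any judgement.
-/

noncomputable section

namespace Summit.ABC.IUTFork

namespace Thm311ToCor312

open Thm311 Cor312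

/-! ## 1. INDEPENDENCE: all typed premises hold, the Statement fails -/

namespace Checks

open Cor312Vol Literature.IUT.LogThetaLattice

/-- The index skeleton of the witness: abc-iut-c312-7's one-place toy (`l⋇ = 2`, one valuation, everything
nonarchimedean and bad). [folklore] -/
abbrev 𝕋 : ThetaIndex := Cor312.Checks.toyIndex

/-- Its log-shells: `log(𝒟^⊢_v) := ℚ` with ONLY the identity as strip-automorphism and as Ism — the "identified
copies" shape in miniature (no indeterminacy moves anything). [folklore] -/
abbrev 𝕃 : LogShells 𝕋 := Cor312.Checks.toyShells

/-- The tensor packets of the witness are NOT the zero module: the pure tensor `1 ⊗ ⋯ ⊗ 1` is nonzero (it pairs to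
`1` with the tensor product of the coordinate functionals, Mathlib's `PiTensorProduct.dualDistrib`). [folklore] -/
theorem exists_ne_zero (j : 𝕋.Label) (vQ : 𝕋.VQ) : ∃ x : 𝕃.Packet j vQ, x ≠ 0 := by
  classical
  let v₀ : 𝕋.Fibre vQ := Classical.arbitrary _
  let m : 𝕋.Caps j → 𝕃.Packet1 vQ := fun _ _ => (1 : ℚ)
  let f : 𝕋.Caps j → Module.Dual ℚ (𝕃.Packet1 vQ) := fun _ => LinearMap.proj v₀
  have h1 : PiTensorProduct.dualDistrib (R := ℚ) (PiTensorProduct.tprod ℚ f) (PiTensorProduct.tprod ℚ m) = 1 := by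
    rw [PiTensorProduct.dualDistrib_apply]
    exact Finset.prod_eq_one fun _ _ => rfl
  refine ⟨PiTensorProduct.tprod ℚ m, fun h => ?_⟩
  have h0 : PiTensorProduct.dualDistrib (R := ℚ) (PiTensorProduct.tprod ℚ f) (PiTensorProduct.tprod ℚ m) = 0 := by
    have h' : (PiTensorProduct.tprod ℚ m : PiTensorProduct ℚ fun _ : 𝕋.Caps j => 𝕃.Packet1 vQ) = 0 := h
    rw [h', map_zero]
  rw [h0] at h1
  exact zero_ne_one h1

/-- `sizeVol` of a whole packet is `−1`. [folklore] -/
theorem sizeVol_univ (j : 𝕋.Label) (vQ : 𝕋.VQ) : sizeVol (Set.univ : Set (𝕃.Packet j vQ)) = -1 := by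
  obtain ⟨x, hx⟩ := exists_ne_zero j vQ
  unfold sizeVol
  rw [if_neg]
  exact fun h => hx (h (Set.mem_univ x))

/-- Data (a)(b)(c) of the witness (the same on every vertical line): integral structures everything, every region
admissible with log-volume `sizeVol`, splitting monoid and number field empty, action zero. [folklore] -/
def idData : MRData 𝕃 where
  shellPk := fun _ _ => Set.univ
  shellSub := fun _ _ => Set.univ
  Adm := fun _ _ _ => True
  logvol := fun _ _ A => sizeVol A
  Ψ := fun _ _ => ∅
  act := fun _ _ _ => 0
  Mmod := fun _ => ∅

/-- One global Frobenioid object, of degree `−1`, whose region is everything (so the degree clause of (i) (c) reads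
`−1 = sizeVol(everything)`). [folklore] -/
def idDegrees (j : 𝕋.LabelStar) : GlobalDegrees 𝕃 j where
  ObjMOD := Unit
  Objmod := Unit
  natIso := Equiv.refl Unit
  deg := fun _ => -1
  region := fun _ _ => Set.univ

/-- The situation of the witness (index data, log-shells, the same data (a)(b)(c) on every vertical line).
[folklore] -/
def idSituation : Situation 𝕋 where
  L := 𝕃
  D := fun _ => idData
  G := fun _ j => idDegrees j

/-- The columns of the witness: holomorphic log-volume `sizeVol` (so (ii) (a) holds), transported splitting monoids
and number fields equal to the coric ones (so (ii) (b), (c) hold), unit images and archimedean balls the zero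
ideal (so (Ind3) holds), one-point Frobenioid objects. [folklore] -/
def idColumn : Column 𝕃 where
  frobAdm := fun _ _ _ _ => True
  frobLogvol := fun _ _ _ A => sizeVol A
  frobΨ := fun _ _ _ => ∅
  frobMmod := fun _ _ => ∅
  unitImage := fun _ _ _ _ => {0}
  ballImage := fun _ _ _ => {0}
  ObjLGP := Unit
  frobObjLGP := fun _ => Unit
  kumLGP := fun _ => Equiv.refl Unit
  ObjLgp := Unit
  frobObjLgp := fun _ => Unit
  kumLgp := fun _ => Equiv.refl Unit
  thetaPilot := fun _ => ()

/-- The full situation of the witness: the situation, the columns, and abc-iut-c312-1's one-object link data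
`Thm311.toyLink` (file E: every poly-isomorphism full, every induced automorphism the identity). [folklore] -/
def idFull : FullSituation 𝕋 where
  toSituation := idSituation
  col := fun _ => idColumn
  link := Thm311.toyLink

/-- Theorem 3.11 (i) holds in the witness: the splitting monoid is (vacuously) in the sub-packets, the degree
`−1` is the log-volume `sizeVol(everything) = −1` summed over the one place, and `ⁿ˒°R^LGP` is the same class for
all `n`. [folklore] -/
theorem id_partI : idFull.PartI := by
  refine ⟨fun n v hv x hx => absurd hx (Set.notMem_empty x), fun n j J => ⟨fun _ => trivial, ?_, ?_⟩,
    fun n n' => rfl⟩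
  · exact Set.toFinite _
  · refine ((finsum_unique _).trans ?_).symm
    exact sizeVol_univ _ _

/-- Theorem 3.11 (ii) holds in the witness, column by column. [folklore] -/
theorem id_partII : idFull.toLatticeSituation.PartII := by
  intro n
  refine (Column.partII_iff _ _).2 ⟨?_, fun _ _ _ => rfl, fun _ _ => rfl, ?_⟩
  · intro m j vQ A _
    exact ⟨trivial, rfl⟩
  · exact ⟨fun m m' j vQ _ => Set.subset_univ _, fun m j vQ h => absurd trivial h⟩

/-- Theorem 3.11 (iii) holds in the witness ((a), (b) always; (c), (d) because every poly-isomorphism of the link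
data is full and every induced automorphism trivial; the final clauses from (i)). [folklore] -/
theorem id_partIII : idFull.PartIII := by
  refine ⟨Thm311.toyLink.partIIIa_holds, Thm311.toyLink.partIIIb_holds, ?_, ?_,
    idFull.evalCompatUpToInd_of_multiradialCompat id_partI.2.2⟩
  · refine Thm311.toyLink.partIIIc_of_full (fun _ => rfl) fun n m => ?_
    rintro p ⟨a, rfl⟩
    rfl
  · intro n m
    exact PolyIsoCalc.stabilized_full _ _

/-- **Theorem 3.11 (i) ∧ (ii) ∧ (iii), AS TYPED, holds in the witness.** [folklore] -/
theorem id_statement : idFull.Statement := ⟨id_partI, id_partII, id_partIII⟩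

/-- (IPL) of Rmk. 3.11.1 (iii), as typed in file F (`LinkData.IPL`: the horizontal full poly-isomorphisms are
nonempty), holds in the witness. [folklore] -/
theorem id_ipl : idFull.link.IPL :=
  Thm311.toyLink.ipl_of_connected fun X Y =>
    ⟨CategoryTheory.eqToIso (by obtain ⟨⟨⟩⟩ := X; obtain ⟨⟨⟩⟩ := Y; rfl)⟩

/-- The generator-level log-volume invariance of file B (`MRData.LogvolInvariant`) holds in the witness: linear
automorphisms preserve `sizeVol`. [folklore] -/
theorem id_logvolInvariant (n : ℤ) : (idFull.D n).LogvolInvariant :=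
  fun Φ _ j vQ A _ => sizeVol_image (Φ j vQ) A

/-- Admissibility is (trivially) transported by the generating families in the witness. [folklore] -/
theorem id_adm_transport (n : ℤ) :
    ∀ Φ ∈ 𝕃.Ind1Family ∪ 𝕃.Ind2Family, ∀ (j : 𝕋.Label) (vQ : 𝕋.VQ) (A : Set (𝕃.Packet j vQ)),
      (idFull.D n).Adm j vQ A ↔ (idFull.D n).Adm j vQ (Φ j vQ '' A) :=
  fun _ _ _ _ _ => Iff.rfl

/-- The group-level invariance of file G (`LogvolIndInvariant`: every indeterminacy generated by (Ind1), (Ind2)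
preserves admissibility and log-volume — Step (x) first clause) holds in the witness. [folklore] -/
theorem id_logvolIndInvariant (n : ℤ) (j : 𝕋.LabelStar) (vQ : 𝕋.VQ) :
    idFull.toLatticeSituation.LogvolIndInvariant n j vQ :=
  fun Φ _ A _ => ⟨trivial, sizeVol_image (Φ j.1 vQ) A⟩

/-! ### The Cor. 3.12 setting of the witness at the 1-column -/

/-- The hull frame of the witness on a module: hull-sets = {the zero ideal, everything}; every subset relatively
compact and admitting a hull (the hull of `U` is `{0}` if `U ⊆ {0}`, everything otherwise). [folklore] -/
def idFrame (X : Type) [Zero X] : HullFrame X where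
  Hul := {{0}, Set.univ}
  IsBounded := fun _ => True
  HasHull := fun _ => True
  hul_bounded := fun _ _ => trivial
  bounded_mono := fun _ _ _ _ => trivial
  exists_hul := fun _ _ => ⟨Set.univ, Set.mem_insert_of_mem _ rfl, Set.subset_univ _⟩
  hull_mem := fun U _ _ => by
    by_cases hU : U ⊆ {0}
    · have h0 : ⋂₀ {H | H ∈ ({{0}, Set.univ} : Set (Set X)) ∧ U ⊆ H} = {0} := by
        refine Set.Subset.antisymm (Set.sInter_subset_of_mem ⟨Set.mem_insert _ _, hU⟩) ?_
        refine Set.subset_sInter ?_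
        rintro H ⟨hH, -⟩
        rcases hH with rfl | hH
        · exact subset_rfl
        · rw [Set.mem_singleton_iff.mp hH]
          exact Set.subset_univ _
      rw [h0]
      exact Set.mem_insert _ _
    · have h1 : {H | H ∈ ({{0}, Set.univ} : Set (Set X)) ∧ U ⊆ H} = {Set.univ} := by
        ext H
        simp only [Set.mem_setOf_eq, Set.mem_insert_iff, Set.mem_singleton_iff]
        constructor
        · rintro ⟨rfl | rfl, hsub⟩
          · exact absurd hsub hU
          · rfl
        · rintro rfl
          exact ⟨Or.inr rfl, Set.subset_univ _⟩
      rw [h1, Set.sInter_singleton]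
      exact Set.mem_insert_of_mem _ rfl

/-- In the witness frame the hull of the zero ideal is the zero ideal. [folklore] -/
theorem idFrame_hull_zero (X : Type) [Zero X] : (idFrame X).hull {0} = {0} :=
  Set.Subset.antisymm ((idFrame X).hull_subset_of_mem (Set.mem_insert _ _) subset_rfl)
    ((idFrame X).subset_hull _)

/-- The SETTING of Cor. 3.12 for the witness at the 1-column (`n := 1`, Step (xi)): lattice `ⁿ˒ᵐ𝓗𝓣 := (n, m)`,
one-point Frobenioids/strips/pilot objects (abc-iut-c312-7's `Cor312.Checks.toySig`), the frame `idFrame` on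
every packet, Θ-pilot region the zero ideal at every `m` (the region algorithm `zeroAlgorithm` applied to the
column's data), q-pilot region everything (a hull-set). [folklore] -/
def idSetting : Setting idSituation where
  n := 1
  HT := ℤ × ℤ
  LogLink := fun _ _ => Unit
  IsFull := fun _ => True
  lattice :=
    { theater := fun n m => (n, m)
      distinct := fun p q h => by simpa using h
      logLink := fun _ _ => ()
      logLink_full := fun _ _ => trivial }
  Frd := Unit
  IsoF := fun _ _ => Unit
  Ob := fun _ => Unit
  realify := id
  Strip := Unit
  IsoS := fun _ _ => Unit
  M := fun _ _ => Unit
  sig := Cor312.Checks.toySig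
  split :=
    { Msplit := fun _ _ => ⊤
      exists_gen := fun _ _ => ⟨⟨(), trivial⟩, Cor312.Checks.top_unit_isGenerator _⟩ }
  ObΔ := Unit
  N := fun _ _ => Unit
  qData :=
    { q := fun _ _ => ()
      q_gen := fun _ _ => Cor312.Checks.unit_isGenerator _
      objOf := fun _ => () }
  frame := fun _ _ => idFrame _
  hul_adm := fun _ _ _ _ => trivial
  thetaRegionOf := fun _ _ _ _ => {0}
  qRegionOf := fun _ _ _ => Set.univ
  qRegion_mem := fun _ _ => Set.mem_insert_of_mem _ rfl
  qSupport_finite := fun _ => Set.toFinite _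

/-- The (Ind3)-enlarged Θ-pilot region of the witness is the zero ideal. [folklore] -/
theorem id_thetaRegion3 (j : 𝕋.Label) (vQ : 𝕋.VQ) : idSetting.thetaRegion3 j vQ = {0} :=
  Set.iUnion_const _

/-- Every possible image of the Θ-pilot object in the witness is the zero ideal (linear automorphisms fix `0`).
[folklore] -/
theorem id_possibleImages (j : 𝕋.Label) (vQ : 𝕋.VQ) : idSetting.possibleImages j vQ = {{0}} := by
  ext U
  simp only [Setting.possibleImages, Set.mem_setOf_eq, Set.mem_singleton_iff, id_thetaRegion3,
    Set.image_singleton, map_zero]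
  constructor
  · rintro ⟨Φ, -, rfl⟩
    rfl
  · rintro rfl
    exact ⟨1, (Setting.indGroup _).one_mem, rfl⟩

/-- The hull `¹˒°𝒰_{j,v_ℚ}` of the witness is the zero ideal. [folklore] -/
theorem id_thetaHull (j : 𝕋.Label) (vQ : 𝕋.VQ) : idSetting.thetaHull j vQ = {0} := by
  unfold Setting.thetaHull
  rw [id_possibleImages, Set.sUnion_singleton]
  exact idFrame_hull_zero _

/-- Every packet union of the witness admits its hull. [folklore] -/
theorem id_hullDefined (j : 𝕋.Label) (vQ : 𝕋.VQ) : idSetting.HullDefined j vQ := ⟨trivial, trivial⟩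
/-- The local Θ-term of the witness is `−2` (the log-volume of the zero ideal). [folklore] -/
theorem id_thetaLocal (j : 𝕋.Label) (vQ : 𝕋.VQ) : idSetting.thetaLocal j vQ = ((-2 : ℝ) : WithTop ℝ) := by
  unfold Setting.thetaLocal
  rw [if_pos (id_hullDefined j vQ), id_thetaHull]
  exact congrArg _ sizeVol_zero

/-- The local q-term of the witness is `−1` (the log-volume of everything). [folklore] -/
theorem id_qLocal (j : 𝕋.Label) (vQ : 𝕋.VQ) : idSetting.qLocal j vQ = -1 := sizeVol_univ j vQ

/-- `ThetaFinite` holds in the witness («−|log(Θ)| is finite»). [folklore] -/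
theorem id_thetaFinite : idSetting.ThetaFinite :=
  ⟨fun i vQ => by rw [id_thetaLocal]; exact WithTop.coe_ne_top, fun _ => Set.toFinite _⟩

/-- `−|log(Θ)| = −2` in the witness. [folklore] -/
theorem id_negLogTheta : idSetting.negLogTheta = ((-2 : ℝ) : WithTop ℝ) := by
  rw [idSetting.negLogTheta_eq_of_thetaFinite id_thetaFinite]
  simp only [id_thetaLocal, WithTop.untopD_coe, finsum_unique]
  exact congrArg _ (processionNormalized_const (by decide) (-2))

/-- `−|log(q)| = −1` in the witness. [folklore] -/
theorem id_negLogQ : idSetting.negLogQ = -1 := by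
  unfold Setting.negLogQ
  simp only [id_qLocal, finsum_unique]
  exact processionNormalized_const (by decide) (-1)

/-- `|log(q)| > 0` in the witness. [folklore] -/
theorem id_absLogQPos : idSetting.AbsLogQPos := by
  show idSetting.negLogQ < 0; rw [id_negLogQ]; norm_num

/-- **The Statement of Cor. 3.12 FAILS in the witness**: `−|log(q)| = −1 ≰ −2 = −|log(Θ)|`. [folklore] -/
theorem id_not_statement : ¬ idSetting.Statement := fun h => by
  have h' := (idSetting.statement_iff_real id_negLogTheta).1 h
  rw [id_negLogQ] at h'
  norm_num at h'

/-- abc-iut-c312-6's bridge hypotheses hold in the witness: log-volume monotone, everything admissible, finite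
supports, hull-sets and Θ-regions nonempty, `ThetaFinite`. [folklore] -/
theorem id_bridgeHyps : BridgeHyps idSetting where
  mono := fun _ _ _ _ _ _ hAB => sizeVol_mono hAB
  image_adm := fun _ _ _ _ => trivial
  image_fin := fun _ => Set.toFinite _
  hul_nonempty := fun j vQ H hH => by
    rcases hH with rfl | hH
    · exact Set.singleton_nonempty 0
    · rw [Set.mem_singleton_iff.mp hH]
      exact Set.univ_nonempty
  theta_nonempty := fun i vQ => by
    rw [id_thetaRegion3]
    exact Set.singleton_nonempty 0
  finite := id_thetaFinite

/-- The licence fails in the witness (as it must, by `statement_of_licence`): everything is not inside the zero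
ideal. [folklore] -/
theorem id_not_licence : ¬ Licence idSetting := fun h =>
  id_not_statement (statement_of_licence id_bridgeHyps h)

/-- The constant region algorithm «zero ideal in every packet» (functorial: linear automorphisms fix `{0}`).
[folklore] -/
def zeroAlgorithm {T : ThetaIndex} (S : Situation T) : RegionAlgorithm S where
  ρ := fun _ _ _ => {0}
  equivariant := fun _ Φ _ j vQ => by rw [Set.image_singleton, map_zero]

/-- The witness setting's Θ-pilot region IS computed by a region algorithm from its column's data. [folklore] -/
theorem id_computedBy : ComputedBy idSetting (zeroAlgorithm idSituation) := fun j vQ => id_thetaRegion3 j vQ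

/-- Step (i)'s object-level pilot correspondence holds in the witness (one-point objects). [folklore] -/
theorem id_pilotLink : PilotLink idSetting := ⟨Equiv.refl Unit, rfl⟩

/-- **INDEPENDENCE of the typed Cor. 3.12 from the typed Thm. 3.11 and the catalogued side conditions.** There is
ONE model — a full situation `S` of Theorem 3.11 with a Cor.-3.12 setting `P` at its 1-column — in which hold
simultaneously: Theorem 3.11 (i) ∧ (ii) ∧ (iii) as typed (`FullSituation.Statement`); (IPL) as typed (file F);
the (Ind1)/(Ind2)-invariance of admissibility and log-volume at generator (file B) and group (file G) level —
Step (x); abc-iut-c312-6's bridge hypotheses (monotone log-volume, admissibility, finite supports, nonempty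
hull-sets and Θ-regions, «−|log(Θ)| finite»); `|log(q)| > 0`; Step (i)'s pilot correspondence at the object
level; and the Θ-pilot region computed functorially from the column's data — while the printed Statement of
Cor. 3.12 is FALSE (`−|log(Θ)| = −2 < −1 = −|log(q)|`). So at the level of the present typing the inequality of
Cor. 3.12 is not a consequence of these premises: a derivation must pass through the `Licence` (Step (xi-f)),
which fails here (`id_not_licence`). No side is taken: the witness is not a model of initial Θ-data.
[folklore] -/
theorem independence :
    ∃ (T : ThetaIndex) (S : FullSituation T) (P : Setting S.toSituation),
      S.Statement ∧ S.link.IPL ∧ (∀ n, (S.D n).LogvolInvariant) ∧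
      (∀ n j vQ, S.toLatticeSituation.LogvolIndInvariant n j vQ) ∧
      BridgeHyps P ∧ P.AbsLogQPos ∧ P.n = 1 ∧ PilotLink P ∧
      (∃ A : RegionAlgorithm S.toSituation, ComputedBy P A) ∧ ¬ P.Statement :=
  ⟨𝕋, idFull, idSetting, id_statement, id_ipl, id_logvolInvariant, id_logvolIndInvariant, id_bridgeHyps,
    id_absLogQPos, rfl, id_pilotLink, ⟨zeroAlgorithm idSituation, id_computedBy⟩, id_not_statement⟩

/-- **No sufficient reading is a consequence of the typed premises.** Any condition `G` on Cor.-3.12 settings that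
yields the printed Statement under the bridge hypotheses — Readings 1/2/3 of the skeleton, Reading 4 (an isomorphic
sub-region of the hull), LANA's (9-1), Team B's volume transport, the `Licence` — FAILS in the witness, although the
witness satisfies every typed premise listed in `independence`. [folklore] -/
theorem no_sufficient_reading {G : ∀ {T : ThetaIndex} {S : Situation T}, Setting S → Prop}
    (hG : ∀ {T : ThetaIndex} {S : Situation T} (P : Setting S), BridgeHyps P → G P → P.Statement) :
    ¬ G idSetting :=
  fun h => id_not_statement (hG idSetting id_bridgeHyps h)

/-- The same, read through abc-iut-c312-6's bridge into the skeleton: a `Cor312Setting` assembled from a verbatim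
setting satisfying every typed premise, in which the skeleton's `Cor312` FAILS and Reading 2 (`QSubHull`) FAILS.
[folklore] -/
theorem independence_skeleton :
    ¬ (toCor312Setting id_bridgeHyps).Cor312 ∧ ¬ (toCor312Setting id_bridgeHyps).QSubHull :=
  ⟨fun h => id_not_statement ((statement_iff_cor312 id_bridgeHyps).mpr h),
    fun h => id_not_licence ((licence_iff_qSubHull id_bridgeHyps).mpr h)⟩

end Checks

end Thm311ToCor312

end Summit.ABC.IUTFork

end
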